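import Mathlib
import Summits.Ventures.PercRepro.TriangleCapGraph

/-!
# PercRepro — corollaries of the graphic closed form (p3, gen 24)

* `card_triangles_le_choose`: the bound of `card_triangles_le_P` in binomial form — if the cyclomatic number is
  `tri t + i` with `i ≤ t + 1` (the paper's `ν = C(k−1,2) + j − 1`, `k = t + 2`, `j = i + 1`), a connected graph has at
  most `C(t+2,3) + C(i+1,2)` triangles.
* `cliqueFinset_top_eq`, `card_cliqueFinset_top`: the complete graph on `n` vertices has `C(n,k)` `k`-cliques.
* `top_sharp`: EVERY complete graph attains the bound — `K_{n+1}` has `C(n+1,3)` triangles and cyclomatic number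
  `C(n,2) = tri (n − 1)`, and `P (tri (n − 1)) = C(n+1,3)` (`KK.P_closed`). So the inequality is sharp at infinitely
  many values of the cyclomatic number (in addition to the `decide` witnesses of `TriangleCapGraph`).
Axioms: standard.
-/

namespace PercRepro

namespace TriangleCap

namespace Graph

open Finset

section Corollaries

variable {V : Type*} [DecidableEq V] (G : SimpleGraph V) [DecidableRel G.Adj]

/-- **The bound in binomial form:** a connected graph whose cyclomatic number is `tri t + i` with `i ≤ t + 1`
(`ν = C(k−1,2) + j − 1` with `k = t + 2`, `j = i + 1`) has at most `C(t+2,3) + C(i+1,2)` triangles. -/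
theorem card_triangles_le_choose [Fintype V] [Fintype G.edgeSet] (h : G.Connected) {t i : ℕ}
    (hi : i ≤ t + 1) (hν : G.edgeFinset.card + 1 = Fintype.card V + (KK.tri t + i)) :
    (G.cliqueFinset 3).card ≤ (t + 2).choose 3 + (i + 1).choose 2 := by
  rw [← KK.P_closed t i hi]
  exact card_triangles_le_P_of_cyclomatic G h hν

end Corollaries

section Complete

variable {V : Type*} [DecidableEq V] [Fintype V]

/-- The `k`-cliques of the complete graph are all the `k`-subsets. -/
theorem cliqueFinset_top_eq (k : ℕ) :
    (⊤ : SimpleGraph V).cliqueFinset k = (univ : Finset V).powersetCard k := by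
  ext t
  rw [SimpleGraph.mem_cliqueFinset_iff, SimpleGraph.isNClique_iff, mem_powersetCard]
  exact ⟨fun h => ⟨subset_univ _, h.2⟩, fun h => ⟨SimpleGraph.IsClique.top _, h.2⟩⟩

/-- The complete graph on `n` vertices has `C(n,k)` `k`-cliques. -/
theorem card_cliqueFinset_top (k : ℕ) :
    ((⊤ : SimpleGraph V).cliqueFinset k).card = (Fintype.card V).choose k := by
  rw [cliqueFinset_top_eq, card_powersetCard, card_univ]

/-- **Every complete graph attains the bound:** `K_{n+1}` has `C(n+1,3)` triangles, `C(n+1,2)` edges, cyclomatic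
number `C(n,2) = tri (n − 1)`, and `P (tri (n − 1)) = C(n+1,3)`. -/
theorem top_sharp (n : ℕ) :
    ((⊤ : SimpleGraph (Fin (n + 1))).cliqueFinset 3).card =
      KK.P ((⊤ : SimpleGraph (Fin (n + 1))).edgeFinset.card + 1 - Fintype.card (Fin (n + 1))) := by
  rw [card_cliqueFinset_top, SimpleGraph.card_edgeFinset_top_eq_card_choose_two, Fintype.card_fin]
  rcases Nat.eq_zero_or_pos n with rfl | hn
  · decide
  · obtain ⟨m, rfl⟩ : ∃ m, n = m + 1 := ⟨n - 1, by omega⟩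
    have h1 : (m + 1 + 1).choose 2 + 1 - (m + 1 + 1) = KK.tri m := by
      have e1 : (m + 1 + 1).choose 2 = (m + 1) + (m + 1).choose 2 := by
        have := Nat.choose_succ_succ (m + 1) 1
        simpa [Nat.choose_one_right] using this
      rw [e1, KK.tri_eq_choose]
      omega
    rw [h1]
    have h3 := KK.P_closed m 0 (Nat.zero_le _)
    rw [add_zero] at h3
    have h4 : (0 + 1).choose 2 = 0 := by decide
    rw [h3, h4, add_zero]

end Complete

end Graph

end TriangleCap

end PercRepro
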